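import Mathlib
import Summits.Ventures.PercRepro2.CoinChainTauLayer
import Summits.Ventures.PercRepro2.CoinChainXASignsLemmas
import Summits.Ventures.PercRepro2.CoinChainWorld1
import Summits.Ventures.PercRepro2.CoinChainMixLsm
import Summits.Ventures.PercRepro2.CoinChainOneMarker
import Summits.Ventures.PercRepro2.CoinChainGenQprime
import Summits.Ventures.PercRepro2.CoinChainXACross

/-!
# (XA′) for the GENERAL AND-switch chain under three sign conditions, and the chain at every
coin probability (blind cell PercRepro2, night-2 g26; proofs/NIGHT2-DARC.md §67)

Notation of `chain_functional_nonneg_of_XA'`: `R⁰ = ν·chainMix ent ent' 0 c d` (moments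
`a0, a1, a2`), `R¹ = ν·chainMix ent ent' 1 c d` (`b`), `G⁰ = ν·chainMix ent ent' 0 c d'` (`e`),
`G¹ = ν·chainMix ent ent' 1 c d'` (`g`).  The three SIGN CONDITIONS, all about the world-0-centred
`x`-shifts of the killed laws `Q = R⁰ − R¹` (coin-killed), `P⁰ = R⁰ − G⁰` (world-0 pivotal) and
`P′ = (R¹ − G¹) − P⁰` (the `D′`-pivotal part):

* `hQx`  : `a0 b1 ≤ a1 b0`  — `Q_x ≥ 0`, i.e. the coin LOWERS the `x`-mean (`ε ≤ 0`);
* `hP0x` : `a0 e1 ≤ a1 e0`  — `P⁰_x ≥ 0`, the world-0 gate lowers the `x`-mean (`σ⁰ ≤ 0`);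
* `hP'x` : `(a0 b1 − a1 b0) − (a0 g1 − a1 g0) + (a0 e1 − a1 e0) ≥ 0` — `P′_x ≥ 0`.

THEOREM (`chain_XA'_of_signs`): under them (XA′) holds, `Cross ≤ a0·U001`; hence
(`chain_functional_nonneg_of_signs`) the general chain at every `ρ ∈ [0, 1]`.  The `y`-versions
follow by the symmetry `x ↔ y` of all statements.

Proof (the τ-layer cake, §67).  By `tau_layer_bound` for the cross pair `(R⁰, G¹)` with entries
`ent ∪ ent'`: `(a2 m − a0 mʸ)·K ≤ m·U001` with `m, mʸ` the ideal mass and `y`-moment and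
`K = ∑ (R⁰ − G¹)(a0 x − a1) = Q_x + P′_x + P⁰_x` (cleared).  Then `K ≥ Q_x + P⁰_x` (`hP'x`), the
factor `a2 m − a0 mʸ ≥ 0` (the ideal is below the world-0 mean), and the two killed `y`-shifts are
bounded by it: `m·P⁰_y ≤ a0 (a2 m − a0 mʸ)` (the world-0 gate's excess on the entered clusters is
nonnegative, `chain_closed_gate_zero`, and the nested ideals `I₀ ⊆ I_e` have increasing means,
`nested_ideal_mean`) and `m·Q_y ≤ a0 (a2 m − a0 mʸ)` (the closed-gate bound
`chain_closed_om_zero`).  With `Q_x, P⁰_x ≥ 0` this gives `m·a0·U001 ≥ m·Cross` (`xa_signs_alg`).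
-/

namespace Summit.Ventures.PercRepro2.Coin

open Classical

section XASignsMain

variable {V : Type*} [DecidableEq V] {R : Type*} [Field R] [LinearOrder R] [IsStrictOrderedRing R]

set_option maxHeartbeats 800000 in
/-- **(XA′) FOR THE GENERAL AND-SWITCH CHAIN UNDER THE THREE `x`-SIGN CONDITIONS**
`hQx : a0 b1 ≤ a1 b0` (the coin lowers the `x`-mean), `hP0x : a0 e1 ≤ a1 e0` (the world-0 gate
lowers the `x`-mean), `hP'x` (the `D′`-pivotal `x`-shift is nonnegative): the conclusion is the
hypothesis `hXA'` of `chain_functional_nonneg_of_XA'`, `Cross ≤ a0·U001`. -/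
theorem chain_XA'_of_signs (U ent ent' : Finset V) (ν c d d' : Finset V → R)
    (hν0 : ∀ W, 0 ≤ ν W)
    (hν : ∀ s ⊆ U, ∀ t ⊆ U, ν s * ν t ≤ ν (s ∩ t) * ν (s ∪ t))
    (hc0 : ∀ W, 0 ≤ c W) (hd0 : ∀ W, 0 ≤ d W) (hd'0 : ∀ W, 0 ≤ d' W)
    (hdc : ∀ W, d W ≤ c W) (hd'c : ∀ W, d' W ≤ c W)
    (hcc : ∀ s t, c s * c t ≤ c (s ∩ t) * c (s ∪ t))
    (hdd : ∀ s t, d s * d t ≤ d (s ∩ t) * d (s ∪ t))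
    (hd'd' : ∀ s t, d' s * d' t ≤ d' (s ∩ t) * d' (s ∪ t))
    (hcd : ∀ s t, c s * d t ≤ c (s ∩ t) * d (s ∪ t))
    (hcd' : ∀ s t, c s * d' t ≤ c (s ∩ t) * d' (s ∪ t))
    (hdd' : ∀ s t, d s * d' t ≤ d (s ∩ t) * d' (s ∪ t))
    (hratio : ∀ s t, s ⊆ t → d s * c t ≤ c s * d t)
    (hratio' : ∀ s t, s ⊆ t → d' s * c t ≤ c s * d' t)
    (x y : Finset V → R) (hx0 : ∀ W, 0 ≤ x W) (hy0 : ∀ W, 0 ≤ y W)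
    (hxm : ∀ s t, x s ≤ x (s ∪ t)) (hym : ∀ s t, y s ≤ y (s ∪ t))
    (hmI : 0 < ∑ W ∈ U.powerset.filter (fun W => ¬ ∃ r ∈ ent ∪ ent', r ∈ W), ν W * c W)
    (hQx : (∑ W ∈ U.powerset, ν W * chainMix ent ent' 0 c d W) *
        (∑ W ∈ U.powerset, ν W * chainMix ent ent' 1 c d W * x W) ≤
      (∑ W ∈ U.powerset, ν W * chainMix ent ent' 0 c d W * x W) *
        (∑ W ∈ U.powerset, ν W * chainMix ent ent' 1 c d W))
    (hP0x : (∑ W ∈ U.powerset, ν W * chainMix ent ent' 0 c d W) *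
        (∑ W ∈ U.powerset, ν W * chainMix ent ent' 0 c d' W * x W) ≤
      (∑ W ∈ U.powerset, ν W * chainMix ent ent' 0 c d W * x W) *
        (∑ W ∈ U.powerset, ν W * chainMix ent ent' 0 c d' W))
    (hP'x : 0 ≤ ((∑ W ∈ U.powerset, ν W * chainMix ent ent' 0 c d W) *
          (∑ W ∈ U.powerset, ν W * chainMix ent ent' 1 c d W * x W)
        - (∑ W ∈ U.powerset, ν W * chainMix ent ent' 0 c d W * x W) *
          (∑ W ∈ U.powerset, ν W * chainMix ent ent' 1 c d W))
      - ((∑ W ∈ U.powerset, ν W * chainMix ent ent' 0 c d W) *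
          (∑ W ∈ U.powerset, ν W * chainMix ent ent' 1 c d' W * x W)
        - (∑ W ∈ U.powerset, ν W * chainMix ent ent' 0 c d W * x W) *
          (∑ W ∈ U.powerset, ν W * chainMix ent ent' 1 c d' W))
      + ((∑ W ∈ U.powerset, ν W * chainMix ent ent' 0 c d W) *
          (∑ W ∈ U.powerset, ν W * chainMix ent ent' 0 c d' W * x W)
        - (∑ W ∈ U.powerset, ν W * chainMix ent ent' 0 c d W * x W) *
          (∑ W ∈ U.powerset, ν W * chainMix ent ent' 0 c d' W))) :
    (((∑ W ∈ U.powerset, ν W * chainMix ent ent' 0 c d W) * (∑ W ∈ U.powerset, ν W * chainMix ent ent' 1 c d W * x W) - (∑ W ∈ U.powerset, ν W * chainMix ent ent' 0 c d W * x W) * (∑ W ∈ U.powerset, ν W * chainMix ent ent' 1 c d W)) *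
          ((∑ W ∈ U.powerset, ν W * chainMix ent ent' 0 c d W) * (∑ W ∈ U.powerset, ν W * chainMix ent ent' 0 c d' W * y W) - (∑ W ∈ U.powerset, ν W * chainMix ent ent' 0 c d W * y W) * (∑ W ∈ U.powerset, ν W * chainMix ent ent' 0 c d' W))
        + ((∑ W ∈ U.powerset, ν W * chainMix ent ent' 0 c d W) * (∑ W ∈ U.powerset, ν W * chainMix ent ent' 1 c d W * y W) - (∑ W ∈ U.powerset, ν W * chainMix ent ent' 0 c d W * y W) * (∑ W ∈ U.powerset, ν W * chainMix ent ent' 1 c d W)) *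
          ((∑ W ∈ U.powerset, ν W * chainMix ent ent' 0 c d W) * (∑ W ∈ U.powerset, ν W * chainMix ent ent' 0 c d' W * x W) - (∑ W ∈ U.powerset, ν W * chainMix ent ent' 0 c d W * x W) * (∑ W ∈ U.powerset, ν W * chainMix ent ent' 0 c d' W))) ≤
        (∑ W ∈ U.powerset, ν W * chainMix ent ent' 0 c d W) * ((∑ W ∈ U.powerset, ν W * chainMix ent ent' 0 c d W) * (∑ W ∈ U.powerset, ν W * chainMix ent ent' 0 c d W) * (∑ W ∈ U.powerset, ν W * chainMix ent ent' 1 c d' W * (x W * y W))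
          - (∑ W ∈ U.powerset, ν W * chainMix ent ent' 0 c d W) * (∑ W ∈ U.powerset, ν W * chainMix ent ent' 0 c d W * y W) * (∑ W ∈ U.powerset, ν W * chainMix ent ent' 1 c d' W * x W)
          - (∑ W ∈ U.powerset, ν W * chainMix ent ent' 0 c d W) * (∑ W ∈ U.powerset, ν W * chainMix ent ent' 0 c d W * x W) * (∑ W ∈ U.powerset, ν W * chainMix ent ent' 1 c d' W * y W)
          + (∑ W ∈ U.powerset, ν W * chainMix ent ent' 0 c d W * x W) * (∑ W ∈ U.powerset, ν W * chainMix ent ent' 0 c d W * y W) * (∑ W ∈ U.powerset, ν W * chainMix ent ent' 1 c d' W)) := by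
  have hm0 : ∀ W, 0 ≤ chainMix ent ent' 0 c d W := chainMix_nonneg ent ent' le_rfl zero_le_one hc0 hd0
  have hm1' : ∀ W, 0 ≤ chainMix ent ent' 1 c d' W :=
    chainMix_nonneg ent ent' zero_le_one le_rfl hc0 hd'0
  have hR0_0 : ∀ W, 0 ≤ ν W * chainMix ent ent' 0 c d W := fun W => mul_nonneg (hν0 W) (hm0 W)
  have hG1_0 : ∀ W, 0 ≤ ν W * chainMix ent ent' 1 c d' W := fun W => mul_nonneg (hν0 W) (hm1' W)
  -- the gate `G¹` is log-supermodular and Holley-above `R⁰` from every cluster meeting `ent ∪ ent'`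
  have hmix' := mixture_lsm ent ent' 1 zero_le_one le_rfl c d' hc0 hd'0 hd'c hcc hd'd' hcd' hratio'
  have wMM : ∀ s ⊆ U, ∀ t ⊆ U, ν s * chainMix ent ent' 1 c d' s * (ν t * chainMix ent ent' 1 c d' t) ≤
      ν (s ∩ t) * chainMix ent ent' 1 c d' (s ∩ t) * (ν (s ∪ t) * chainMix ent ent' 1 c d' (s ∪ t)) := by
    intro s hs t ht
    calc ν s * chainMix ent ent' 1 c d' s * (ν t * chainMix ent ent' 1 c d' t)
        = (ν s * ν t) * (chainMix ent ent' 1 c d' s * chainMix ent ent' 1 c d' t) := by ring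
      _ ≤ (ν (s ∩ t) * ν (s ∪ t)) *
            (chainMix ent ent' 1 c d' (s ∩ t) * chainMix ent ent' 1 c d' (s ∪ t)) :=
          mul_le_mul (hν s hs t ht) (hmix' s t) (mul_nonneg (hm1' _) (hm1' _))
            (mul_nonneg (hν0 _) (hν0 _))
      _ = _ := by ring
  have wML : ∀ s ⊆ U, ∀ t ⊆ U, (∃ r ∈ ent ∪ ent', r ∈ s) →
      ν s * chainMix ent ent' 1 c d' s * (ν t * chainMix ent ent' 0 c d t) ≤
        ν (s ∩ t) * chainMix ent ent' 0 c d (s ∩ t) * (ν (s ∪ t) * chainMix ent ent' 1 c d' (s ∪ t)) := by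
    intro s hs t ht hse
    have hsu : ∃ r ∈ ent ∪ ent', r ∈ s ∪ t := by
      obtain ⟨r, hr, hrs⟩ := hse; exact ⟨r, hr, Finset.mem_union_left _ hrs⟩
    rw [chainMix_one_of_meet ent ent' c d' hse, chainMix_one_of_meet ent ent' c d' hsu]
    calc ν s * d' s * (ν t * chainMix ent ent' 0 c d t)
        = (ν s * ν t) * (d' s * chainMix ent ent' 0 c d t) := by ring
      _ ≤ (ν (s ∩ t) * ν (s ∪ t)) * (chainMix ent ent' 0 c d (s ∩ t) * d' (s ∪ t)) :=
          mul_le_mul (hν s hs t ht)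
            (chain_cross_holley ent ent' 0 le_rfl zero_le_one c d d' hdc hcd' hdd' hd'0 s t)
            (mul_nonneg (hd'0 _) (hm0 _)) (mul_nonneg (hν0 _) (hν0 _))
      _ = _ := by ring
  -- the τ-layer-cake bound for the cross pair `(R⁰, G¹)` with entries `ent ∪ ent'`
  have hTL := tau_layer_bound U (ent ∪ ent') (fun W => ν W * chainMix ent ent' 0 c d W)
    (fun W => ν W * chainMix ent ent' 1 c d' W) x y hR0_0 hG1_0 hx0 hy0 hxm hym wMM wML
  beta_reduce at hTL
  -- the ideal filters agree with the form of `hmI`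
  have hfilt : U.powerset.filter (fun W => W ∩ (ent ∪ ent') = ∅) =
      U.powerset.filter (fun W => ¬ ∃ r ∈ ent ∪ ent', r ∈ W) :=
    Finset.filter_congr fun W _ => inter_eq_empty_iff_not_meets (ent ∪ ent') W
  have hN : (∑ W ∈ U.powerset.filter (fun W => W ∩ (ent ∪ ent') = ∅),
      ν W * chainMix ent ent' 1 c d' W) =
      ∑ W ∈ U.powerset.filter (fun W => ¬ ∃ r ∈ ent ∪ ent', r ∈ W), ν W * c W := by
    rw [hfilt]
    exact Finset.sum_congr rfl fun W hW => by
      rw [chainMix_of_not_meet ent ent' 1 c d' (Finset.mem_filter.1 hW).2]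
  have hNy : (∑ W ∈ U.powerset.filter (fun W => W ∩ (ent ∪ ent') = ∅),
      ν W * chainMix ent ent' 1 c d' W * y W) =
      ∑ W ∈ U.powerset.filter (fun W => ¬ ∃ r ∈ ent ∪ ent', r ∈ W), ν W * c W * y W := by
    rw [hfilt]
    exact Finset.sum_congr rfl fun W hW => by
      rw [chainMix_of_not_meet ent ent' 1 c d' (Finset.mem_filter.1 hW).2]
  rw [hN, hNy] at hTL
  -- the gate functional is `U001`
  have hSG := centred_expand_sc (fun W => ν W * chainMix ent ent' 1 c d' W) x y U.powerset
    (∑ W ∈ U.powerset, ν W * chainMix ent ent' 0 c d W)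
    (∑ W ∈ U.powerset, ν W * chainMix ent ent' 0 c d W * x W)
    (∑ W ∈ U.powerset, ν W * chainMix ent ent' 0 c d W * y W)
  beta_reduce at hSG
  rw [hSG] at hTL
  -- the killed `x`-shift `K = a1 g0 − a0 g1`
  have hK : (∑ W ∈ U.powerset, (ν W * chainMix ent ent' 0 c d W - ν W * chainMix ent ent' 1 c d' W) *
      ((∑ W ∈ U.powerset, ν W * chainMix ent ent' 0 c d W) * x W -
        (∑ W ∈ U.powerset, ν W * chainMix ent ent' 0 c d W * x W))) =
      (∑ W ∈ U.powerset, ν W * chainMix ent ent' 0 c d W * x W) *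
          (∑ W ∈ U.powerset, ν W * chainMix ent ent' 1 c d' W) -
        (∑ W ∈ U.powerset, ν W * chainMix ent ent' 0 c d W) *
          (∑ W ∈ U.powerset, ν W * chainMix ent ent' 1 c d' W * x W) := by
    rw [Finset.sum_congr rfl (fun W _ => show
      (ν W * chainMix ent ent' 0 c d W - ν W * chainMix ent ent' 1 c d' W) *
        ((∑ W ∈ U.powerset, ν W * chainMix ent ent' 0 c d W) * x W -
          (∑ W ∈ U.powerset, ν W * chainMix ent ent' 0 c d W * x W)) =
      ((∑ W ∈ U.powerset, ν W * chainMix ent ent' 0 c d W) * (ν W * chainMix ent ent' 0 c d W * x W)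
        - (∑ W ∈ U.powerset, ν W * chainMix ent ent' 0 c d W * x W) * (ν W * chainMix ent ent' 0 c d W))
      - ((∑ W ∈ U.powerset, ν W * chainMix ent ent' 0 c d W) * (ν W * chainMix ent ent' 1 c d' W * x W)
        - (∑ W ∈ U.powerset, ν W * chainMix ent ent' 0 c d W * x W) * (ν W * chainMix ent ent' 1 c d' W))
      from by ring)]
    rw [Finset.sum_sub_distrib, Finset.sum_sub_distrib, Finset.sum_sub_distrib,
      ← Finset.mul_sum, ← Finset.mul_sum, ← Finset.mul_sum, ← Finset.mul_sum]
    ring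
  rw [hK] at hTL
  -- the ideal is below the world-0 `y`-mean
  have hD := chain_ideal_le_global_zero U ent ent' ν c d hν0 hν hc0 hd0 hdc hcc hdd hcd hratio y hy0 hym
  -- masses: `m ≤ a0`, `m_e ≤ a0`
  have hm_le : (∑ W ∈ U.powerset.filter (fun W => ¬ ∃ r ∈ ent ∪ ent', r ∈ W), ν W * c W) ≤
      ∑ W ∈ U.powerset, ν W * chainMix ent ent' 0 c d W := by
    have e : (∑ W ∈ U.powerset.filter (fun W => ¬ ∃ r ∈ ent ∪ ent', r ∈ W), ν W * c W) =
        ∑ W ∈ U.powerset.filter (fun W => ¬ ∃ r ∈ ent ∪ ent', r ∈ W),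
          ν W * chainMix ent ent' 0 c d W :=
      Finset.sum_congr rfl fun W hW => by
        rw [chainMix_of_not_meet ent ent' 0 c d (Finset.mem_filter.1 hW).2]
    rw [e]
    exact Finset.sum_le_sum_of_subset_of_nonneg (Finset.filter_subset _ _) fun W _ _ => hR0_0 W
  have hme_le : (∑ W ∈ U.powerset.filter (fun W => ¬ ∃ r ∈ ent, r ∈ W), ν W * c W) ≤
      ∑ W ∈ U.powerset, ν W * chainMix ent ent' 0 c d W := by
    have e : (∑ W ∈ U.powerset.filter (fun W => ¬ ∃ r ∈ ent, r ∈ W), ν W * c W) =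
        ∑ W ∈ U.powerset.filter (fun W => ¬ ∃ r ∈ ent, r ∈ W), ν W * chainMix ent ent' 0 c d W :=
      Finset.sum_congr rfl fun W hW => by
        rw [chainMix_zero_of_not_meet_ent ent ent' c d (Finset.mem_filter.1 hW).2]
    rw [e]
    exact Finset.sum_le_sum_of_subset_of_nonneg (Finset.filter_subset _ _) fun W _ _ => hR0_0 W
  -- (β): the coin-killed `y`-shift through the closed-gate bound
  have hom := chain_closed_om_zero U ent ent' ν c d hν0 hν hc0 hd0 hdc hdd hcd y hy0 hym
  have hsplitb0 : (∑ W ∈ U.powerset, ν W * chainMix ent ent' 1 c d W) =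
      (∑ W ∈ U.powerset.filter (fun W => ¬ ∃ r ∈ ent ∪ ent', r ∈ W), ν W * c W) +
        ∑ W ∈ U.powerset.filter (fun W => ∃ r ∈ ent ∪ ent', r ∈ W), ν W * d W := by
    rw [← Finset.sum_filter_add_sum_filter_not U.powerset (fun W => ∃ r ∈ ent ∪ ent', r ∈ W),
      add_comm]
    congr 1
    · exact Finset.sum_congr rfl fun W hW => by
        rw [chainMix_of_not_meet ent ent' 1 c d (Finset.mem_filter.1 hW).2]
    · exact Finset.sum_congr rfl fun W hW => by
        rw [chainMix_one_of_meet ent ent' c d (Finset.mem_filter.1 hW).2]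
  have hsplitb2 : (∑ W ∈ U.powerset, ν W * chainMix ent ent' 1 c d W * y W) =
      (∑ W ∈ U.powerset.filter (fun W => ¬ ∃ r ∈ ent ∪ ent', r ∈ W), ν W * c W * y W) +
        ∑ W ∈ U.powerset.filter (fun W => ∃ r ∈ ent ∪ ent', r ∈ W), ν W * d W * y W := by
    rw [← Finset.sum_filter_add_sum_filter_not U.powerset (fun W => ∃ r ∈ ent ∪ ent', r ∈ W),
      add_comm]
    congr 1
    · exact Finset.sum_congr rfl fun W hW => by
        rw [chainMix_of_not_meet ent ent' 1 c d (Finset.mem_filter.1 hW).2]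
    · exact Finset.sum_congr rfl fun W hW => by
        rw [chainMix_one_of_meet ent ent' c d (Finset.mem_filter.1 hW).2]
  -- (α): the world-0 pivotal `y`-shift through the closed-gate bound for `d'`
  have hcg := chain_closed_gate_zero U ent ent' ν c d d' hν0 hν hc0 hd0 hd'0 hdc hd'd' hcd' hdd' y hy0 hym
  have hsplite0 : (∑ W ∈ U.powerset, ν W * chainMix ent ent' 0 c d' W) =
      (∑ W ∈ U.powerset.filter (fun W => ¬ ∃ r ∈ ent, r ∈ W), ν W * c W) +
        ∑ W ∈ U.powerset.filter (fun W => ∃ r ∈ ent, r ∈ W), ν W * d' W := by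
    rw [← Finset.sum_filter_add_sum_filter_not U.powerset (fun W => ∃ r ∈ ent, r ∈ W), add_comm]
    congr 1
    · exact Finset.sum_congr rfl fun W hW => by
        rw [chainMix_zero_of_not_meet_ent ent ent' c d' (Finset.mem_filter.1 hW).2]
    · exact Finset.sum_congr rfl fun W hW => by
        rw [chainMix_zero_of_meet_ent ent ent' c d' (Finset.mem_filter.1 hW).2]
  have hsplite2 : (∑ W ∈ U.powerset, ν W * chainMix ent ent' 0 c d' W * y W) =
      (∑ W ∈ U.powerset.filter (fun W => ¬ ∃ r ∈ ent, r ∈ W), ν W * c W * y W) +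
        ∑ W ∈ U.powerset.filter (fun W => ∃ r ∈ ent, r ∈ W), ν W * d' W * y W := by
    rw [← Finset.sum_filter_add_sum_filter_not U.powerset (fun W => ∃ r ∈ ent, r ∈ W), add_comm]
    congr 1
    · exact Finset.sum_congr rfl fun W hW => by
        rw [chainMix_zero_of_not_meet_ent ent ent' c d' (Finset.mem_filter.1 hW).2]
    · exact Finset.sum_congr rfl fun W hW => by
        rw [chainMix_zero_of_meet_ent ent ent' c d' (Finset.mem_filter.1 hW).2]
  -- the nested ideals
  have hnest := nested_ideal_mean U ent ent' ν c hν0 hν hc0 hcc y hy0 hym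
  have ha0 : 0 ≤ ∑ W ∈ U.powerset, ν W * chainMix ent ent' 0 c d W :=
    Finset.sum_nonneg fun W _ => hR0_0 W
  have hmnn : 0 ≤ ∑ W ∈ U.powerset.filter (fun W => ¬ ∃ r ∈ ent ∪ ent', r ∈ W), ν W * c W :=
    hmI.le
  refine xa_signs_alg _ _ _ _ _ _ _ _ _ _ _ _ _ _ _ _ _ ha0 hmnn hmI hTL (by linarith [hD])
    hm_le hme_le ?_ ?_ hnest (by linarith [hQx]) (by linarith [hP0x]) (by linarith [hP'x])
  · rw [hsplitb0, hsplitb2]; linarith [hom]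
  · rw [hsplite0, hsplite2]; linarith [hcg]

end XASignsMain

section XASignsChain

variable {V : Type*} [DecidableEq V] {R : Type*} [Field R] [LinearOrder R] [IsStrictOrderedRing R]

/-- **THE GENERAL AND-SWITCH CHAIN AT EVERY COIN PROBABILITY UNDER THE THREE `x`-SIGN
CONDITIONS** (`chain_functional_nonneg_of_XA'` with `hXA'` discharged by `chain_XA'_of_signs`). -/
theorem chain_functional_nonneg_of_signs (U ent ent' : Finset V) (ν c d d' : Finset V → R)
    (ρ : R) (hρ0 : 0 ≤ ρ) (hρ1 : ρ ≤ 1) (hν0 : ∀ W, 0 ≤ ν W)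
    (hν : ∀ s ⊆ U, ∀ t ⊆ U, ν s * ν t ≤ ν (s ∩ t) * ν (s ∪ t))
    (hc0 : ∀ W, 0 ≤ c W) (hd0 : ∀ W, 0 ≤ d W) (hd'0 : ∀ W, 0 ≤ d' W)
    (hdc : ∀ W, d W ≤ c W) (hd'c : ∀ W, d' W ≤ c W) (hd'd : ∀ W, d' W ≤ d W)
    (hcc : ∀ s t, c s * c t ≤ c (s ∩ t) * c (s ∪ t))
    (hdd : ∀ s t, d s * d t ≤ d (s ∩ t) * d (s ∪ t))
    (hd'd' : ∀ s t, d' s * d' t ≤ d' (s ∩ t) * d' (s ∪ t))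
    (hcd : ∀ s t, c s * d t ≤ c (s ∩ t) * d (s ∪ t))
    (hcd' : ∀ s t, c s * d' t ≤ c (s ∩ t) * d' (s ∪ t))
    (hdd' : ∀ s t, d s * d' t ≤ d (s ∩ t) * d' (s ∪ t))
    (hratio : ∀ s t, s ⊆ t → d s * c t ≤ c s * d t)
    (hratio' : ∀ s t, s ⊆ t → d' s * c t ≤ c s * d' t)
    (x y : Finset V → R) (hx0 : ∀ W, 0 ≤ x W) (hy0 : ∀ W, 0 ≤ y W)
    (hxm : ∀ s t, x s ≤ x (s ∪ t)) (hym : ∀ s t, y s ≤ y (s ∪ t))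
    (hpos0 : 0 < ∑ W ∈ U.powerset, ν W * chainMix ent ent' 0 c d W)
    (hpos1 : 0 < ∑ W ∈ U.powerset, ν W * chainMix ent ent' 1 c d W)
    (hmI : 0 < ∑ W ∈ U.powerset.filter (fun W => ¬ ∃ r ∈ ent ∪ ent', r ∈ W), ν W * c W)
    (hQx : (∑ W ∈ U.powerset, ν W * chainMix ent ent' 0 c d W) *
        (∑ W ∈ U.powerset, ν W * chainMix ent ent' 1 c d W * x W) ≤
      (∑ W ∈ U.powerset, ν W * chainMix ent ent' 0 c d W * x W) *
        (∑ W ∈ U.powerset, ν W * chainMix ent ent' 1 c d W))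
    (hP0x : (∑ W ∈ U.powerset, ν W * chainMix ent ent' 0 c d W) *
        (∑ W ∈ U.powerset, ν W * chainMix ent ent' 0 c d' W * x W) ≤
      (∑ W ∈ U.powerset, ν W * chainMix ent ent' 0 c d W * x W) *
        (∑ W ∈ U.powerset, ν W * chainMix ent ent' 0 c d' W))
    (hP'x : 0 ≤ ((∑ W ∈ U.powerset, ν W * chainMix ent ent' 0 c d W) *
          (∑ W ∈ U.powerset, ν W * chainMix ent ent' 1 c d W * x W)
        - (∑ W ∈ U.powerset, ν W * chainMix ent ent' 0 c d W * x W) *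
          (∑ W ∈ U.powerset, ν W * chainMix ent ent' 1 c d W))
      - ((∑ W ∈ U.powerset, ν W * chainMix ent ent' 0 c d W) *
          (∑ W ∈ U.powerset, ν W * chainMix ent ent' 1 c d' W * x W)
        - (∑ W ∈ U.powerset, ν W * chainMix ent ent' 0 c d W * x W) *
          (∑ W ∈ U.powerset, ν W * chainMix ent ent' 1 c d' W))
      + ((∑ W ∈ U.powerset, ν W * chainMix ent ent' 0 c d W) *
          (∑ W ∈ U.powerset, ν W * chainMix ent ent' 0 c d' W * x W)
        - (∑ W ∈ U.powerset, ν W * chainMix ent ent' 0 c d W * x W) *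
          (∑ W ∈ U.powerset, ν W * chainMix ent ent' 0 c d' W))) :
    0 ≤ (∑ W ∈ U.powerset, ν W * chainMix ent ent' ρ c d W) ^ 2 *
          (∑ W ∈ U.powerset, ν W * chainMix ent ent' ρ c d' W * (x W * y W))
        - (∑ W ∈ U.powerset, ν W * chainMix ent ent' ρ c d W) *
          (∑ W ∈ U.powerset, ν W * chainMix ent ent' ρ c d W * x W) *
          (∑ W ∈ U.powerset, ν W * chainMix ent ent' ρ c d' W * y W)
        - (∑ W ∈ U.powerset, ν W * chainMix ent ent' ρ c d W) *
          (∑ W ∈ U.powerset, ν W * chainMix ent ent' ρ c d W * y W) *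
          (∑ W ∈ U.powerset, ν W * chainMix ent ent' ρ c d' W * x W)
        + (∑ W ∈ U.powerset, ν W * chainMix ent ent' ρ c d W * x W) *
          (∑ W ∈ U.powerset, ν W * chainMix ent ent' ρ c d W * y W) *
          (∑ W ∈ U.powerset, ν W * chainMix ent ent' ρ c d' W) :=
  chain_functional_nonneg_of_XA' U ent ent' ν c d d' ρ hρ0 hρ1 hν0 hν hc0 hd0 hd'0 hdc hd'c hd'd
    hcc hdd hd'd' hcd hcd' hdd' hratio hratio' x y hx0 hy0 hxm hym hpos0 hpos1 hmI
    (chain_XA'_of_signs U ent ent' ν c d d' hν0 hν hc0 hd0 hd'0 hdc hd'c hcc hdd hd'd' hcd hcd'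
      hdd' hratio hratio' x y hx0 hy0 hxm hym hmI hQx hP0x hP'x)

end XASignsChain

end Summit.Ventures.PercRepro2.Coin
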